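import Literature.Geometry.Riemannian.DirectionalBarrierMaximumPrinciple
import Literature.Geometry.Riemannian.HeatKernelMeasures
import HarnessLib

/-!
# Barrier sub-solutions of the heat equation are dominated by the heat kernel measures
# (Bamler 2020a, §2.3 and §9: `s ↦ ∫ u(·,s) dν_{x,t;s}` is non-increasing for `□u ≤ 0` in the
# barrier sense)

R. Bamler, *Entropy and heat kernel bounds on a Ricci flow background*, arXiv:2008.07093 (2020a),
§2.3: for `u ∈ C²`, `d/ds ∫ u dν_{x,t;s} = ∫ □u dν_{x,t;s}`, so sub-solutions `□u ≤ 0` have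
non-increasing pairings with the conjugate heat kernel measures `ν_{x,t;s}`; in §9 (proof of the
`H_n`-centre location proposition under `|Ric| ≤ K r⁻²`, via the cut-off sub-solution
`u = e^{-C t} φ(d_t(x₀,·))` of the preceding lemma, for which `□u ≤ 0` holds only "in the barrier
and viscosity sense") the same is used for functions that are merely continuous, with `□u ≤ 0` in
the BARRIER sense: `ν_{x₀,1;0}(B(x₀,0,c₀)) ≥ ∫ u dν_{x₀,1;0} ≥ u(x₀,1) ≥ c₁`.

This file proves the barrier-sense statement, away from the pole, for a `C^∞` family `h` of
Riemannian metrics on a closed connected manifold `M` (modelled on `ℝᵐ`) carrying a Ricci flow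
`hflow = (h, cov)` on `[a, T]`, with the tree's heat kernel measures
`ν_{x,t;s} = heatKernelMeasure hh hR t x s` (`HeatKernelMeasures.lean`) and with the barrier
datum in the DIRECTIONAL form of `directional_barrier_maximum_principle`
(`DirectionalBarrierMaximumPrinciple.lean`): at every `(y, r)`, `r ∈ (s₁, s₂]`, and for every
`η > 0`, an `h(r)`-orthonormal frame `(eᵢ)` at `y`, one-variable lower barriers
`Bᵢ(σ) ≤ w(exp_y(σ eᵢ), r)` touching at `σ = 0` with second derivatives `bᵢ` at `0`, and a lower
left time barrier `Bᵗ ≤ w(y, ·)` touching at `r` with left derivative `p`, subject to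
`p − Σᵢ bᵢ ≤ c + η` (i.e. `□w ≤ c` in the barrier sense):

* `integral_heatKernelMeasure_le_of_directionalBarrier` — for `a < s₁ < s₂ < t ≤ T` and `w`
  continuous on `M × [s₁, s₂]` with this datum,
  `∫ w(·,s₂) dν_{x,t;s₂} ≤ ∫ w(·,s₁) dν_{x,t;s₁} + c (s₂ − s₁)`.

Proof: for `δ > 0` pick a smooth `φ` with `w(·,s₁) ≤ φ ≤ w(·,s₁) + δ`
(`exists_contMDiff_abs_sub_lt`), let `U` be the smooth forward heat solution on `[s₁, t]` with
`U(s₁) = φ` (`exists_isHeatSolutionOn_heatValue`); the comparison principle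
`directional_barrier_maximum_principle` gives `w ≤ U + c (r − s₁)` on `M × [s₁, s₂]`; integrate
at `r = s₂` against the probability measure `ν_{x,t;s₂}` and use
`∫ U(·,s₂) dν_{x,t;s₂} = (P_{s₂→t} P_{s₁→s₂} φ)(x) = (P_{s₁→t} φ)(x) = ∫ φ dν_{x,t;s₁}`
(`integral_heatKernelMeasure_eq_heatValue`, `heatValue_trans`); finally `δ → 0`.
Everything is proved; no definitions, no named facts. What is NOT here: the evaluation at the
pole `s₂ = t` (`w(x,t) ≤ ∫ w(·,s₁) dν_{x,t;s₁} + c (t − s₁)`), super Ricci flows, non-compact `M`.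

## References

* R. H. Bamler, *Entropy and heat kernel bounds on a Ricci flow background*, arXiv:2008.07093
  (2020), §2.3 (`d/dt ∫ u dν_{x₀,t₀;t} = ∫ □u dν_{x₀,t₀;t}`), §9 (proof of the `H_n`-centre
  location proposition, Prop. 9.5 — Prop. 33 / Lemma 37 in the sequential numbering of the arXiv
  text: `∫ u dν ≥ u(x₀, t₀)` for a barrier sub-solution `u`). [Bamler2020Entropy]
* E. Calabi, *An extension of E. Hopf's maximum principle with an application to Riemannian
  geometry*, Duke Math. J. 25 (1958), 45–56 (barrier sub-solutions).
-/

noncomputable section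

open Set Filter Function MeasureTheory Measure
open scoped Manifold ContDiff Topology ENNReal NNReal

namespace Literature.Geometry.Riemannian

open Lorentzian Lorentzian.PseudoRiemannianMetric

section Pairing

variable {m : ℕ} {H : Type*} [TopologicalSpace H]
  {I : ModelWithCorners ℝ (EuclideanSpace ℝ (Fin m)) H} [I.Boundaryless]
  {M : Type*} [TopologicalSpace M] [ChartedSpace H M] [IsManifold I ∞ M]
  [T2Space M] [CompactSpace M] [SecondCountableTopology M] [MeasurableSpace M] [BorelSpace M]
  {h : ℝ → PseudoRiemannianMetric I ∞ (EuclideanSpace ℝ (Fin m)) (TangentSpace I : M → Type _)}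

/-- **Pairing a smooth forward heat solution with the heat kernel measures is constant in the
evaluation time** (Bamler 2020a, §2.3, the reproduction formula / `d/ds ∫ u dν_{x,t;s} = 0` for
`□u = 0`): if `U` is a smooth solution of `∂ᵣU = Δ_{h(r)} U` on `M × [s₁, t]` and
`s₁ ≤ s₂ < t`, then `∫ U(·,s₂) dν_{x,t;s₂} = ∫ U(·,s₁) dν_{x,t;s₁}`
(`(P_{s₂→t} P_{s₁→s₂} φ)(x) = (P_{s₁→t} φ)(x)`, `heatValue_trans`).
[cite: Bamler2020Entropy, §2.3] -/
theorem IsHeatSolutionOn.integral_heatKernelMeasure_eq (hh : IsContMDiffFamilyOn ∞ h univ)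
    (hR : ∀ r, (h r).IsRiemannian) {U : ℝ → M → ℝ} {s₁ s₂ t : ℝ} (hU : IsHeatSolutionOn h U s₁ t)
    (h12 : s₁ ≤ s₂) (hs₂t : s₂ < t) (x : M) :
    ∫ y, U s₂ y ∂(heatKernelMeasure hh hR t x s₂) =
      ∫ y, U s₁ y ∂(heatKernelMeasure hh hR t x s₁) := by
  have hs₁t : s₁ < t := h12.trans_lt hs₂t
  have hφ : ContMDiff I 𝓘(ℝ, ℝ) ∞ (U s₁) := hU.contMDiff_slice ⟨le_rfl, hs₁t.le⟩
  have hU₂ : ContMDiff I 𝓘(ℝ, ℝ) ∞ (U s₂) := hU.contMDiff_slice ⟨h12, hs₂t.le⟩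
  -- `U s₂ = P_{s₁→s₂} (U s₁)` by uniqueness
  obtain ⟨U', hU', hU'0, hv⟩ := exists_isHeatSolutionOn_heatValue hh hR hs₁t hφ
  have hUU' : ∀ r ∈ Icc s₁ t, ∀ y, U' r y = U r y := fun r hr y ↦
    hU'.unique hR hs₁t hU hU'0 hr y
  have e : (fun y ↦ heatValue h s₁ s₂ y (U s₁)) = U s₂ := funext fun y ↦ by
    rw [hv s₂ ⟨h12, hs₂t.le⟩ y, hUU' s₂ ⟨h12, hs₂t.le⟩ y]
  rw [integral_heatKernelMeasure_eq_heatValue hh hR hs₂t x hU₂,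
    integral_heatKernelMeasure_eq_heatValue hh hR hs₁t x hφ, heatValue_trans hh hR h12 hs₂t.le x hφ,
    e]

end Pairing

/-- **Barrier sub-solutions of the heat equation are dominated by the heat kernel measures**
(Bamler 2020a, §2.3: `d/ds ∫ u dν_{x,t;s} = ∫ □u dν_{x,t;s}`; §9, proof of Prop. 9.5:
`∫ u dν_{x₀,t₀;s} ≥ u(x₀,t₀)` for the barrier sub-solution `u` of the preceding lemma). Let
`(h, cov)` be a Ricci flow on `[a, T]` of a smooth family of Riemannian metrics on a closed
connected manifold, `t ∈ (a, T]`, `x ∈ M`, `a < s₁ < s₂ < t`, and let `w : M × [s₁, s₂] → ℝ` be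
continuous and a sub-solution `□w ≤ c` in the DIRECTIONAL BARRIER sense: at every `(y, r)`,
`r ∈ (s₁, s₂]`, for every `η > 0` there are an `h(r)`-orthonormal frame `(eᵢ)` at `y`,
one-variable lower barriers `Bᵢ(σ) ≤ w(exp_y(σ eᵢ), r)` near `σ = 0`, touching, twice
differentiable at `0` with second derivatives `bᵢ`, and a lower time barrier `Bᵗ ≤ w(y, ·)` on
the left of `r`, touching, with left derivative `p`, such that `p − Σᵢ bᵢ ≤ c + η`. Then

  `∫ w(·,s₂) dν_{x,t;s₂} ≤ ∫ w(·,s₁) dν_{x,t;s₁} + c (s₂ − s₁)`.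

Proof: smooth `φ` with `w(·,s₁) ≤ φ ≤ w(·,s₁) + δ`, the forward heat solution `U` from `φ` on
`[s₁, t]`, the comparison principle `directional_barrier_maximum_principle` (`w ≤ U + c(r − s₁)`),
integration against `ν_{x,t;s₂}`, `∫ U(s₂) dν_{x,t;s₂} = ∫ φ dν_{x,t;s₁}`
(`IsHeatSolutionOn.integral_heatKernelMeasure_eq`), and `δ → 0`.
[cite: Bamler2020Entropy, §2.3 and §9, proof of Prop. 9.5] -/
theorem integral_heatKernelMeasure_le_of_directionalBarrier {m : ℕ} {H : Type*} [TopologicalSpace H]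
    {I : ModelWithCorners ℝ (EuclideanSpace ℝ (Fin m)) H} [I.Boundaryless]
    {M : Type*} [TopologicalSpace M] [ChartedSpace H M] [IsManifold I ∞ M]
    [T2Space M] [CompactSpace M] [SecondCountableTopology M] [MeasurableSpace M] [BorelSpace M]
    [ConnectedSpace M]
    {h : ℝ → PseudoRiemannianMetric I ∞ (EuclideanSpace ℝ (Fin m)) (TangentSpace I : M → Type _)}
    [∀ r, (h r).HasLeviCivita]
    {cov : ℝ → CovariantDerivative I (EuclideanSpace ℝ (Fin m)) (TangentSpace I : M → Type _)}
    {a T : ℝ} (_hflow : IsRicciFlow h cov (Icc a T))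
    (hh : IsContMDiffFamilyOn ∞ h univ) (hR : ∀ r, (h r).IsRiemannian) {t : ℝ} (_ht : t ∈ Ioc a T)
    (x : M) {s₁ s₂ : ℝ} (_has₁ : a < s₁) (h12 : s₁ < s₂) (hs₂t : s₂ < t) {w : M → ℝ → ℝ}
    (hwc : ContinuousOn (fun p : M × ℝ ↦ w p.1 p.2) (univ ×ˢ Icc s₁ s₂)) {c : ℝ}
    (hbar : ∀ y, ∀ r ∈ Ioc s₁ s₂, ∀ η > 0,
      ∃ (e : Fin (Module.finrank ℝ (EuclideanSpace ℝ (Fin m))) → TangentSpace I y)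
        (B B' : Fin (Module.finrank ℝ (EuclideanSpace ℝ (Fin m))) → ℝ → ℝ)
        (b : Fin (Module.finrank ℝ (EuclideanSpace ℝ (Fin m))) → ℝ) (Bt : ℝ → ℝ) (p : ℝ),
        (∀ i j, (h r).val y (e i) (e j) = if i = j then 1 else 0) ∧
        (∀ i, (∀ᶠ σ in 𝓝 (0 : ℝ), HasDerivAt (B i) (B' i σ) σ) ∧ HasDerivAt (B' i) (b i) 0 ∧
          B i 0 = w y r ∧
          ∀ᶠ σ in 𝓝 (0 : ℝ), B i σ ≤ w (expMap (h r).leviCivita y (σ • e i)) r) ∧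
        (HasDerivWithinAt Bt p (Iic r) r ∧ Bt r = w y r ∧ ∀ᶠ r' in 𝓝[<] r, Bt r' ≤ w y r') ∧
        p - ∑ i, b i ≤ c + η) :
    ∫ y, w y s₂ ∂(heatKernelMeasure hh hR t x s₂) ≤
      ∫ y, w y s₁ ∂(heatKernelMeasure hh hR t x s₁) + c * (s₂ - s₁) := by
  have h2 : (2 : ℕ∞ω) ≤ ((⊤ : ℕ∞) : ℕ∞ω) := WithTop.coe_le_coe.mpr le_top
  -- slices of `w` are continuous, hence integrable against the probability measures `ν`
  have hws : ∀ r ∈ Icc s₁ s₂, Continuous fun y ↦ w y r := fun r hr ↦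
    hwc.comp_continuous (continuous_id.prodMk continuous_const) fun y ↦ ⟨mem_univ _, hr⟩
  have hiw₁ : Integrable (fun y ↦ w y s₁) (heatKernelMeasure hh hR t x s₁) :=
    (hws s₁ (left_mem_Icc.2 h12.le)).integrable_of_hasCompactSupport
      (HasCompactSupport.of_compactSpace _)
  have hiw₂ : Integrable (fun y ↦ w y s₂) (heatKernelMeasure hh hR t x s₂) :=
    (hws s₂ (right_mem_Icc.2 h12.le)).integrable_of_hasCompactSupport
      (HasCompactSupport.of_compactSpace _)
  refine le_of_forall_pos_le_add fun δ hδ ↦ ?_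
  -- a smooth `φ` with `w(·, s₁) ≤ φ ≤ w(·, s₁) + δ`
  obtain ⟨ψ, hψ, hψδ⟩ := exists_contMDiff_abs_sub_lt I (hws s₁ (left_mem_Icc.2 h12.le))
    (half_pos hδ)
  set φ : M → ℝ := fun y ↦ ψ y + δ / 2 with hφdef
  have hφ : ContMDiff I 𝓘(ℝ, ℝ) ∞ φ := hψ.add contMDiff_const
  have hφ1 : ∀ y, w y s₁ ≤ φ y := fun y ↦ by
    have := (abs_lt.1 (hψδ y)).1
    simp only [hφdef]
    linarith
  have hφ2 : ∀ y, φ y ≤ w y s₁ + δ := fun y ↦ by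
    have := (abs_lt.1 (hψδ y)).2
    simp only [hφdef]
    linarith
  -- the forward heat solution `U` on `[s₁, t]` with `U(s₁) = φ`
  obtain ⟨U, hU, hU0, -⟩ := exists_isHeatSolutionOn_heatValue hh hR (h12.trans hs₂t) hφ
  have hIcc : ∀ r ∈ Ioc s₁ s₂, r ∈ Icc s₁ t := fun r hr ↦ ⟨hr.1.le, hr.2.trans hs₂t.le⟩
  -- the comparison principle on `M × [s₁, s₂]`: `w ≤ U + c (r − s₁)`
  have hcomp : ∀ y, ∀ r ∈ Icc s₁ s₂, w y r ≤ U r y + c * (r - s₁) := by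
    have hsub : (univ : Set M) ×ˢ Icc s₁ s₂ ⊆ (univ : Set M) ×ˢ Icc s₁ t :=
      prod_mono le_rfl (Icc_subset_Icc le_rfl hs₂t.le)
    refine directional_barrier_maximum_principle (ψ := w) (U := fun y r ↦ U r y) hR hwc
      (hU.1.continuousOn.mono hsub) (fun r hr ↦ (hU.contMDiff_slice (hIcc r hr)).of_le h2)
      (fun y r hr ↦ (hU.2 r (hIcc r hr) y).hasDerivAt (Icc_mem_nhds hr.1 (hr.2.trans_lt hs₂t)))
      hbar fun y ↦ ?_
    show w y s₁ ≤ U s₁ y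
    rw [hU0]
    exact hφ1 y
  -- integrate at `r = s₂` against `ν_{x,t;s₂}`
  have hiU₂ : Integrable (U s₂) (heatKernelMeasure hh hR t x s₂) :=
    (hU.contMDiff_slice ⟨h12.le, hs₂t.le⟩).continuous.integrable_of_hasCompactSupport
      (HasCompactSupport.of_compactSpace _)
  have hiφ : Integrable φ (heatKernelMeasure hh hR t x s₁) :=
    hφ.continuous.integrable_of_hasCompactSupport (HasCompactSupport.of_compactSpace _)
  have step1 : ∫ y, w y s₂ ∂(heatKernelMeasure hh hR t x s₂) ≤
      ∫ y, U s₂ y ∂(heatKernelMeasure hh hR t x s₂) + c * (s₂ - s₁) := by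
    calc ∫ y, w y s₂ ∂(heatKernelMeasure hh hR t x s₂)
        ≤ ∫ y, (U s₂ y + c * (s₂ - s₁)) ∂(heatKernelMeasure hh hR t x s₂) :=
          integral_mono hiw₂ (hiU₂.add (integrable_const _)) fun y ↦
            hcomp y s₂ (right_mem_Icc.2 h12.le)
      _ = ∫ y, U s₂ y ∂(heatKernelMeasure hh hR t x s₂) + c * (s₂ - s₁) := by
          rw [integral_add hiU₂ (integrable_const _), integral_const, probReal_univ, one_smul]
  -- `∫ U(s₂) dν_{x,t;s₂} = ∫ φ dν_{x,t;s₁}`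
  have step2 : ∫ y, U s₂ y ∂(heatKernelMeasure hh hR t x s₂) =
      ∫ y, φ y ∂(heatKernelMeasure hh hR t x s₁) := by
    rw [hU.integral_heatKernelMeasure_eq hh hR h12.le hs₂t x, hU0]
  -- `∫ φ dν_{x,t;s₁} ≤ ∫ w(·,s₁) dν_{x,t;s₁} + δ`
  have step3 : ∫ y, φ y ∂(heatKernelMeasure hh hR t x s₁) ≤
      ∫ y, w y s₁ ∂(heatKernelMeasure hh hR t x s₁) + δ := by
    calc ∫ y, φ y ∂(heatKernelMeasure hh hR t x s₁)
        ≤ ∫ y, (w y s₁ + δ) ∂(heatKernelMeasure hh hR t x s₁) :=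
          integral_mono hiφ (hiw₁.add (integrable_const _)) fun y ↦ hφ2 y
      _ = ∫ y, w y s₁ ∂(heatKernelMeasure hh hR t x s₁) + δ := by
          rw [integral_add hiw₁ (integrable_const _), integral_const, probReal_univ, one_smul]
  linarith

end Literature.Geometry.Riemannian

end
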